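import Summits.CriticalPhenomena.SAWScalingLimit.Theses.SAWEdgeOfPositiveType
import Literature.Probability.RandomPlanarGeometry.SelfAvoidingWalkProofs

/-!
# Refutation of `SAWEdgeOfPositiveType.InfiniteDivisibility` (item stmt-CriticalPhenomena-8261)

The Hadamard powers of the confined-SAW polymer kernel `Z^Λ_x(u,v) = Σ_{SAW u → v inside Λ} x^{|ω|}`
are NOT all positive definite: for the two-hole site set `Λ = theta(8,2)` (31 sites), `x = 1/16 ≤ x_c`,
`t = 1/256`, the vector `(2,2,-1,-1,-2)` on the two branch points `(0,2),(8,2)` and the corridor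
midpoints `(4,4),(4,0),(4,2)` has quadratic form `≈ -0.0196 < 0` (the graph metric of a two-hole
site set is not of negative type — `K_{2,3}`/theta obstruction — and `-log Z ≈ (-log x)·d_Λ`;
Schoenberg).  The gate accepts only `¬ Theses`-typed theorems from refuters, so the whole argument is
ONE theorem whose helper facts are local `have`s; the computable enumerator of confined self-avoiding
paths (`pathsZ`, evaluated by kernel `decide`) and the other small definitions it needs are the only
top-level declarations besides it.  The refuted decl was then dropped from the route; it is
re-created privately below, so the theorem's (append-only) statement is unchanged and nothing depends
on the retired route name.
-/

open Literature.Probability.LatticeModels Literature.Probability.RandomPlanarGeometry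
open Literature.Probability.RandomPlanarGeometry.SAW.Zd (sawFun mem_sawFun)
open scoped Classical

/-- PRIVATE re-creation (route namespace stays free; a refuted statement, NOT a cited fact) of the
route decl `…Theses.SAWEdgeOfPositiveType.InfiniteDivisibility`, stmt-CriticalPhenomena-8261, DROPPED
from the route at its repair (2026-08-15T16:57:29Z) after the refutation below, so the name left
`Theses/SAWEdgeOfPositiveType.lean` (full-build breakage 2026-08-16, `Unknown identifier`): the item's
recorded signature verbatim, so that the append-only refuting theorem (and its `Iff.rfl` unfolding to
`Zfun`) keeps elaborating. -/
private def Summit.CriticalPhenomena.SAWScalingLimit.Theses.SAWEdgeOfPositiveType.InfiniteDivisibility :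
    Prop :=
  ∀ (Λ : Finset (Literature.Probability.LatticeModels.Site 2)) (x t : ℝ), 0 ≤ x →
    x ≤ Literature.Probability.RandomPlanarGeometry.SAW.criticalFugacity → 0 < t →
    let Z : Literature.Probability.LatticeModels.Site 2 → Literature.Probability.LatticeModels.Site 2 → ℝ :=
      fun u v => ∑ n ∈ Finset.range Λ.card,
        ∑ _ω ∈ (Literature.Probability.RandomPlanarGeometry.SAW.Zd.sawFun 2 n (v - u)).filter
          (fun ω => ∀ i ≤ n, u + ω i ∈ Λ), x ^ n;
    (Matrix.of fun a b : Λ => Z a.1 b.1 ^ t).PosDef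

namespace Summit.CriticalPhenomena.SAWScalingLimit.Theorems

namespace IDRefutation

/-- Coordinates of a planar site. [folklore] -/
def ofSite (x : Site 2) : ℤ × ℤ := (x 0, x 1)

/-- The site with prescribed coordinates. [folklore] -/
def toSite (z : ℤ × ℤ) : Site 2 := ![z.1, z.2]

/-- The four lattice neighbours, in coordinates. [folklore] -/
def nbrsZ (z : ℤ × ℤ) : List (ℤ × ℤ) := [(z.1 + 1, z.2), (z.1, z.2 + 1), (z.1 - 1, z.2), (z.1, z.2 - 1)]

/-- One-step extensions of a reversed path by unvisited neighbours inside `L`. [folklore] -/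
def extendZ (L : List (ℤ × ℤ)) : List (ℤ × ℤ) → List (List (ℤ × ℤ))
  | [] => []
  | z :: rest =>
    ((nbrsZ z).filter fun w => decide (w ∈ L) && !decide (w ∈ z :: rest)).map fun w => w :: z :: rest

/-- All `n`-step self-avoiding paths inside `L` from `p`, as reversed site lists. [folklore] -/
def pathsZ (L : List (ℤ × ℤ)) (p : ℤ × ℤ) : ℕ → List (List (ℤ × ℤ))
  | 0 => [[p]]
  | n + 1 => (pathsZ L p n).flatMap (extendZ L)

/-- The number of `n`-step self-avoiding paths inside `L` from `p` to `q`. [folklore] -/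
def cntZ (L : List (ℤ × ℤ)) (p q : ℤ × ℤ) (n : ℕ) : ℕ :=
  ((pathsZ L p n).filter fun l => l.head? = some q).length

/-- The reversed coordinate trace `[u + ω n, …, u + ω 0]` of a walk. [folklore] -/
def trace (u : Site 2) (ω : ℕ → Site 2) : ℕ → List (ℤ × ℤ)
  | 0 => [ofSite (u + ω 0)]
  | n + 1 => ofSite (u + ω (n + 1)) :: trace u ω n

/-- `theta(8,2)` in nonnegative coordinates: rows `y = 0, 2, 4` (`0 ≤ i ≤ 8`) and the column sites
`(0,1), (0,3), (8,1), (8,3)` — 31 sites, two lattice holes. [folklore] -/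
def lamList : List (ℤ × ℤ) :=
  [(0,0),(1,0),(2,0),(3,0),(4,0),(5,0),(6,0),(7,0),(8,0),
   (0,2),(1,2),(2,2),(3,2),(4,2),(5,2),(6,2),(7,2),(8,2),
   (0,4),(1,4),(2,4),(3,4),(4,4),(5,4),(6,4),(7,4),(8,4), (0,1),(0,3),(8,1),(8,3)]

/-- The site set of the counterexample. [folklore] -/
noncomputable def Λ₀ : Finset (Site 2) := (lamList.map toSite).toFinset

/-- The polymer kernel of the statement. [folklore] -/
noncomputable def Zfun (Λ : Finset (Site 2)) (x : ℝ) (u v : Site 2) : ℝ :=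
  ∑ n ∈ Finset.range Λ.card, ∑ _ω ∈ (sawFun 2 n (v - u)).filter (fun ω => ∀ i ≤ n, u + ω i ∈ Λ), x ^ n

/-- The test vector `(2, 2, -1, -1, -2)` on `(0,2), (8,2), (4,4), (4,0), (4,2)`. [folklore] -/
noncomputable def fval (s : Site 2) : ℝ :=
  (if s = toSite (0, 2) then 2 else 0) + (if s = toSite (8, 2) then 2 else 0) +
    (if s = toSite (4, 4) then -1 else 0) + (if s = toSite (4, 0) then -1 else 0) + (if s = toSite (4, 2) then -2 else 0)

end IDRefutation

set_option maxHeartbeats 4000000 in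
open IDRefutation in
/-- **Refutation of `InfiniteDivisibility`** (item stmt-CriticalPhenomena-8261 of route
SAWEdgeOfPositiveType): for `Λ = theta(8,2)`, `x = 1/16 ≤ x_c`, `t = 1/256`, the Hadamard power
`(Z^Λ_x(a,b)^t)` is not positive definite — the vector `(2,2,-1,-1,-2)` on the two branch points and
the three corridor midpoints has negative quadratic form.  Exact enumeration of the confined walks
(completeness bridge `trace`/`pathsZ` to `SAW.Zd.sawFun`, kernel `decide`), lower bounds from explicit
walks, rational bounds on 256-th roots, `linarith`. [folklore] -/
theorem SAWEdgeOfPositiveTypeInfiniteDivisibility_refuted :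
    ¬ Summit.CriticalPhenomena.SAWScalingLimit.Theses.SAWEdgeOfPositiveType.InfiniteDivisibility := by
  -- ### coordinates
  have site_eq_iff : ∀ x y : Site 2, x = y ↔ x 0 = y 0 ∧ x 1 = y 1 := fun x y =>
    ⟨fun h => by simp [h], fun ⟨h0, h1⟩ => funext fun i => by fin_cases i <;> assumption⟩
  have hOT : ∀ z : ℤ × ℤ, ofSite (toSite z) = z := fun z => by simp [ofSite, toSite]
  have hTO : ∀ x : Site 2, toSite (ofSite x) = x := fun x => by rw [site_eq_iff]; simp [toSite, ofSite]
  have ofSite_inj : Function.Injective ofSite := fun x y h => by rw [← hTO x, ← hTO y, h]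
  have toSite_inj : Function.Injective toSite := fun z z' h => by rw [← hOT z, ← hOT z', h]
  have adj_iff : ∀ x y : Site 2, (zdGraph 2).Adj x y ↔ ofSite y ∈ nbrsZ (ofSite x) := by
    intro x y
    rw [zdGraph_adj_iff]
    simp only [Fin.exists_fin_two, site_eq_iff, Pi.add_apply, Pi.single_apply, nbrsZ, ofSite,
      List.mem_cons, List.mem_nil_iff, Prod.mk.injEq, or_false]
    simp only [OfNat.ofNat_ne_one, ↓reduceIte, add_zero, Fin.zero_eq_one_iff, one_ne_zero]
    omega
  have adj_add : ∀ u a b : Site 2, (zdGraph 2).Adj (u + a) (u + b) ↔ (zdGraph 2).Adj a b := by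
    intro u a b; rw [zdGraph_adj_iff, zdGraph_adj_iff]; simp only [add_assoc, add_right_inj]
  -- ### the enumerator is complete
  have mem_ext : ∀ {L : List (ℤ × ℤ)} {w z : ℤ × ℤ} {rest : List (ℤ × ℤ)}, w ∈ nbrsZ z → w ∈ L →
      w ∉ z :: rest → w :: z :: rest ∈ extendZ L (z :: rest) := by
    intro L w z rest hw hL hnot
    simp only [extendZ, List.mem_map, List.mem_filter, Bool.and_eq_true, decide_eq_true_eq,
      Bool.not_eq_true', decide_eq_false_iff_not]
    exact ⟨w, ⟨hw, hL, hnot⟩, rfl⟩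
  have trace_cons : ∀ (u : Site 2) (ω : ℕ → Site 2) (n : ℕ), ∃ rest, trace u ω n = ofSite (u + ω n) :: rest :=
    fun u ω n => by cases n <;> exact ⟨_, rfl⟩
  have head_trace : ∀ (u : Site 2) (ω : ℕ → Site 2) (n : ℕ), (trace u ω n).head? = some (ofSite (u + ω n)) :=
    fun u ω n => by cases n <;> rfl
  have mem_trace : ∀ {u : Site 2} {ω : ℕ → Site 2} {n : ℕ} {z : ℤ × ℤ},
      z ∈ trace u ω n → ∃ i ≤ n, z = ofSite (u + ω i) := by
    intro u ω n z
    induction n with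
    | zero => intro h; simp only [trace, List.mem_singleton] at h; exact ⟨0, le_rfl, h⟩
    | succ n ih =>
      intro h
      simp only [trace, List.mem_cons] at h
      rcases h with h | h
      · exact ⟨n + 1, le_rfl, h⟩
      · obtain ⟨i, hi, rfl⟩ := ih h; exact ⟨i, Nat.le_succ_of_le hi, rfl⟩
  have complete : ∀ (L : List (ℤ × ℤ)) (Λ : Finset (Site 2)), (∀ s, s ∈ Λ ↔ ofSite s ∈ L) →
      ∀ (u : Site 2) (ω : ℕ → Site 2), ω 0 = 0 → ∀ n, (∀ i < n, (zdGraph 2).Adj (ω i) (ω (i + 1))) →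
      Set.InjOn ω {i | i ≤ n} → (∀ i ≤ n, u + ω i ∈ Λ) → trace u ω n ∈ pathsZ L (ofSite u) n := by
    intro L Λ hΛ u ω h0 n
    induction n with
    | zero => intro _ _ _; simp [trace, pathsZ, h0]
    | succ n ih =>
      intro hadj hinj hmem
      have ih' := ih (fun i hi => hadj i (Nat.lt_succ_of_lt hi))
        (hinj.mono fun i (hi : i ≤ n) => Nat.le_succ_of_le hi) (fun i hi => hmem i (Nat.le_succ_of_le hi))
      simp only [pathsZ, List.mem_flatMap]
      refine ⟨trace u ω n, ih', ?_⟩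
      obtain ⟨rest, hrest⟩ := trace_cons u ω n
      rw [trace, hrest]
      apply mem_ext
      · rw [← adj_iff, adj_add]; exact hadj n (Nat.lt_succ_self n)
      · exact (hΛ _).1 (hmem (n + 1) le_rfl)
      · rw [← hrest]
        intro hx
        obtain ⟨i, hi, heq⟩ := mem_trace hx
        have hi' : n + 1 = i := hinj (by simp) (Nat.le_succ_of_le hi) (add_left_cancel (ofSite_inj heq))
        omega
  have trace_inj : ∀ {u : Site 2} {ω₁ ω₂ : ℕ → Site 2} {n : ℕ}, trace u ω₁ n = trace u ω₂ n →
      ∀ i ≤ n, ω₁ i = ω₂ i := by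
    intro u ω₁ ω₂ n
    induction n with
    | zero =>
      intro h i hi
      obtain rfl : i = 0 := Nat.le_zero.1 hi
      simp only [trace, List.cons.injEq, and_true] at h
      exact add_left_cancel (ofSite_inj h)
    | succ n ih =>
      intro h i hi
      simp only [trace, List.cons.injEq] at h
      rcases Nat.of_le_succ hi with hi' | rfl
      · exact ih h.2 i hi'
      · exact add_left_cancel (ofSite_inj h.1)
  have card_le : ∀ (L : List (ℤ × ℤ)) (Λ : Finset (Site 2)), (∀ s, s ∈ Λ ↔ ofSite s ∈ L) →
      ∀ (u w : Site 2) (n : ℕ), ((sawFun 2 n w).filter fun ω => ∀ i ≤ n, u + ω i ∈ Λ).card ≤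
        cntZ L (ofSite u) (ofSite (u + w)) n := by
    intro L Λ hΛ u w n
    have h1 : ((sawFun 2 n w).filter fun ω => ∀ i ≤ n, u + ω i ∈ Λ).card ≤
        (((pathsZ L (ofSite u) n).filter fun l => l.head? = some (ofSite (u + w))).toFinset).card := by
      apply Finset.card_le_card_of_injOn (fun ω => trace u ω n)
      · intro ω hω
        simp only [Finset.mem_coe, Finset.mem_filter, mem_sawFun] at hω
        obtain ⟨⟨h0, hend, hadj, hinj⟩, hmem⟩ := hω
        simp only [Finset.mem_coe, List.mem_toFinset, List.mem_filter]
        refine ⟨complete L Λ hΛ u ω h0 n hadj hinj hmem, ?_⟩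
        rw [head_trace, hend n le_rfl]; simp
      · intro ω₁ h₁ ω₂ h₂ heq
        simp only [Finset.mem_coe, Finset.mem_filter, mem_sawFun] at h₁ h₂
        funext i
        rcases le_or_gt i n with hi | hi
        · exact trace_inj heq i hi
        · rw [h₁.1.2.1 i hi.le, h₂.1.2.1 i hi.le]
    exact h1.trans (List.toFinset_card_le _)
  -- ### the instance
  have memΛ : ∀ s, s ∈ Λ₀ ↔ ofSite s ∈ lamList := by
    intro s; unfold Λ₀; rw [List.mem_toFinset, List.mem_map]
    exact ⟨by rintro ⟨z, hz, rfl⟩; simpa [hOT] using hz, fun h => ⟨ofSite s, h, hTO s⟩⟩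
  have memΛ' : ∀ {p : ℤ × ℤ}, p ∈ lamList → toSite p ∈ Λ₀ := fun hp => by rw [memΛ, hOT]; exact hp
  have cardΛ : Λ₀.card = 31 := by
    unfold Λ₀; rw [List.toFinset_card_of_nodup ((List.nodup_map_iff toSite_inj).2 (by decide))]; rfl
  have Zeq : ∀ u v : Site 2, Zfun Λ₀ (1 / 16) u v = ∑ n ∈ Finset.range 31,
      (((sawFun 2 n (v - u)).filter (fun ω => ∀ i ≤ n, u + ω i ∈ Λ₀)).card : ℝ) * (1 / 16 : ℝ) ^ n := by
    intro u v; simp [Zfun, Finset.sum_const, nsmul_eq_mul, cardΛ]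
  have Znonneg : ∀ u v : Site 2, 0 ≤ Zfun Λ₀ (1 / 16) u v := fun u v => by
    rw [Zeq]; exact Finset.sum_nonneg fun n _ => mul_nonneg (Nat.cast_nonneg _) (pow_nonneg (by norm_num) n)
  have Zle : ∀ (p q : ℤ × ℤ) (c : ℕ → ℕ), (∀ n, n < 31 → cntZ lamList p q n ≤ c n) →
      Zfun Λ₀ (1 / 16) (toSite p) (toSite q) ≤ ∑ n ∈ Finset.range 31, (c n : ℝ) * (1 / 16 : ℝ) ^ n := by
    intro p q c hc
    rw [Zeq]
    refine Finset.sum_le_sum fun n hn => mul_le_mul_of_nonneg_right ?_ (pow_nonneg (by norm_num) n)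
    have h1 := card_le lamList Λ₀ memΛ (toSite p) (toSite q - toSite p) n
    rw [add_sub_cancel, hOT, hOT] at h1
    exact_mod_cast h1.trans (hc n (Finset.mem_range.1 hn))
  have Zge : ∀ (u v : Site 2) (n : ℕ), n < 31 →
      ((sawFun 2 n (v - u)).filter (fun ω => ∀ i ≤ n, u + ω i ∈ Λ₀)).Nonempty →
      (1 / 16 : ℝ) ^ n ≤ Zfun Λ₀ (1 / 16) u v := by
    intro u v n hn hne
    rw [Zeq]
    have h1 : (1 : ℝ) * (1 / 16 : ℝ) ^ n ≤
        (((sawFun 2 n (v - u)).filter (fun ω => ∀ i ≤ n, u + ω i ∈ Λ₀)).card : ℝ) * (1 / 16 : ℝ) ^ n :=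
      mul_le_mul_of_nonneg_right (by exact_mod_cast Finset.one_le_card.2 hne) (pow_nonneg (by norm_num) n)
    rw [one_mul] at h1
    exact h1.trans (Finset.single_le_sum (f := fun m => (((sawFun 2 m (v - u)).filter
      (fun ω => ∀ i ≤ m, u + ω i ∈ Λ₀)).card : ℝ) * (1 / 16 : ℝ) ^ m)
      (fun m _ => mul_nonneg (Nat.cast_nonneg _) (pow_nonneg (by norm_num) m)) (Finset.mem_range.2 hn))
  -- a confined walk from an explicit coordinate path
  have path : ∀ (l : List (ℤ × ℤ)) (a b : ℤ × ℤ) (n : ℕ), l.length = n + 1 → l.head? = some a →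
      l[n]? = some b → (∀ z ∈ l, z ∈ lamList) → (∀ i, i < n → l.getD (i + 1) b ∈ nbrsZ (l.getD i b)) →
      l.Nodup → ((sawFun 2 n (toSite b - toSite a)).filter (fun ω => ∀ i ≤ n, toSite a + ω i ∈ Λ₀)).Nonempty := by
    intro l a b n hlen hhead hlast hmem hadj hnodup
    have hgetD : ∀ i (hi : i < n + 1), l.getD i b = l[i]'(by omega) := fun i hi =>
      List.getD_eq_getElem _ _ (by omega)
    have h0 : l.getD 0 b = a := by
      cases l with
      | nil => simp at hlen
      | cons c t => simp at hhead; simp [hhead]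
    have hn' : l.getD n b = b := by rw [List.getD_eq_getElem?_getD, hlast]; rfl
    have hge : ∀ i, n ≤ i → l.getD i b = b := by
      intro i hi
      rcases eq_or_lt_of_le hi with rfl | hlt
      · exact hn'
      · exact List.getD_eq_default _ _ (by omega)
    refine ⟨fun i => -toSite a + toSite (l.getD i b), ?_⟩
    rw [Finset.mem_filter, mem_sawFun]
    refine ⟨⟨?_, ?_, ?_, ?_⟩, ?_⟩
    · show -toSite a + toSite (l.getD 0 b) = 0
      rw [h0, neg_add_cancel]
    · intro i hi; rw [hge i hi, neg_add_eq_sub]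
    · intro i hi; rw [adj_add, adj_iff, hOT, hOT]; exact hadj i hi
    · intro i hi j hj hij
      simp only [Set.mem_setOf_eq] at hi hj
      have h1 : l.getD i b = l.getD j b := toSite_inj (add_left_cancel hij)
      rw [hgetD i (by omega), hgetD j (by omega)] at h1
      exact (hnodup.getElem_inj_iff).1 h1
    · intro i hi
      rw [add_neg_cancel_left, memΛ, hOT]
      apply hmem; rw [hgetD i (by omega)]; exact List.getElem_mem _
  -- ### numerical bounds (x = 1/16, t = 1/256)
  have rootle : ∀ {z r : ℝ}, 0 ≤ z → 0 ≤ r → z ≤ r ^ 256 → z ^ ((1 : ℝ) / 256) ≤ r := by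
    intro z r hz hr h
    calc z ^ ((1 : ℝ) / 256) ≤ (r ^ 256) ^ ((1 : ℝ) / 256) := Real.rpow_le_rpow hz h (by norm_num)
      _ = r := by
        rw [one_div, show (256 : ℝ) = ((256 : ℕ) : ℝ) by norm_num]
        exact Real.pow_rpow_inv_natCast hr (by norm_num)
  have leroot : ∀ {z l : ℝ}, 0 ≤ l → l ^ 256 ≤ z → l ≤ z ^ ((1 : ℝ) / 256) := by
    intro z l hl h
    calc l = (l ^ 256) ^ ((1 : ℝ) / 256) := by
          rw [one_div, show (256 : ℝ) = ((256 : ℕ) : ℝ) by norm_num]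
          exact (Real.pow_rpow_inv_natCast hl (by norm_num)).symm
      _ ≤ z ^ ((1 : ℝ) / 256) := Real.rpow_le_rpow (pow_nonneg hl _) h (by norm_num)
  have diag : ∀ p : ℤ × ℤ, p ∈ lamList → (∀ n, n < 31 → cntZ lamList p p n ≤ (if n = 0 then 1 else 0)) →
      Zfun Λ₀ (1 / 16) (toSite p) (toSite p) = 1 := by
    intro p hp hc
    apply le_antisymm
    · exact (Zle p p _ hc).trans (le_of_eq (by simp))
    · simpa using Zge (toSite p) (toSite p) 0 (by norm_num)
        (path [p] p p 0 rfl rfl rfl (by simpa using hp) (by intro i hi; omega) (List.nodup_singleton p))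
  have up : ∀ (p q : ℤ × ℤ) (c : ℕ → ℕ) (r : ℝ), ∑ n ∈ Finset.range 31, (c n : ℝ) * (1 / 16 : ℝ) ^ n ≤ r ^ 256 →
      0 ≤ r → (∀ n, n < 31 → cntZ lamList p q n ≤ c n) →
      Zfun Λ₀ (1 / 16) (toSite p) (toSite q) ^ ((1 : ℝ) / 256) ≤ r :=
    fun p q c r hsum hr hc => rootle (Znonneg _ _) hr ((Zle p q c hc).trans hsum)
  have low : ∀ (a b : ℤ × ℤ) (n : ℕ), n < 31 → ∀ r : ℝ, 0 ≤ r → r ^ 256 ≤ (1 / 16 : ℝ) ^ n →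
      ∀ l : List (ℤ × ℤ), l.length = n + 1 → l.head? = some a → l[n]? = some b → (∀ z ∈ l, z ∈ lamList) →
      (∀ i, i < n → l.getD (i + 1) b ∈ nbrsZ (l.getD i b)) → l.Nodup →
      r ≤ Zfun Λ₀ (1 / 16) (toSite a) (toSite b) ^ ((1 : ℝ) / 256) :=
    fun a b n hn r hr hrn l hlen hhead hlast hmem hadj hnodup => leroot hr (hrn.trans
      (Zge (toSite a) (toSite b) n hn (path l a b n hlen hhead hlast hmem hadj hnodup)))
  have hsUU : ∑ n ∈ Finset.range 31, (((fun n : ℕ => (if n = 8 then 1 else if n = 12 then 2 else 0 : ℕ)) n : ℕ) : ℝ) *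
      (1 / 16 : ℝ) ^ n ≤ 0.91701 ^ 256 := by
    simp [Finset.sum_range_succ]; norm_num
  have hsTB : ∑ n ∈ Finset.range 31, (((fun n : ℕ => (if n = 12 then 2 else if n = 20 then 2 else 0 : ℕ)) n : ℕ) : ℝ) *
      (1 / 16 : ℝ) ^ n ≤ 0.8806 ^ 256 := by
    simp [Finset.sum_range_succ]; norm_num
  have hsTM : ∑ n ∈ Finset.range 31, (((fun n : ℕ => (if n = 10 then 2 else if n = 22 then 2 else 0 : ℕ)) n : ℕ) : ℝ) *
      (1 / 16 : ℝ) ^ n ≤ 0.8999 ^ 256 := by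
    simp [Finset.sum_range_succ]; norm_num
  have hr6 : (0.937 : ℝ) ^ 256 ≤ (1 / 16 : ℝ) ^ 6 := by norm_num
  have hr4 : (0.9575 : ℝ) ^ 256 ≤ (1 / 16 : ℝ) ^ 4 := by norm_num
  -- ### the test vector and the quadratic form
  have sum_fval : ∀ g : Site 2 → ℝ, ∑ s ∈ Λ₀, fval s * g s = 2 * g (toSite (0, 2)) + 2 * g (toSite (8, 2))
      - g (toSite (4, 4)) - g (toSite (4, 0)) - 2 * g (toSite (4, 2)) := by
    intro g
    have h1 : toSite (0, 2) ∈ Λ₀ := memΛ' (by decide)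
    have h2 : toSite (8, 2) ∈ Λ₀ := memΛ' (by decide)
    have h3 : toSite (4, 4) ∈ Λ₀ := memΛ' (by decide)
    have h4 : toSite (4, 0) ∈ Λ₀ := memΛ' (by decide)
    have h5 : toSite (4, 2) ∈ Λ₀ := memΛ' (by decide)
    simp only [fval, add_mul, ite_mul, zero_mul, Finset.sum_add_distrib, Finset.sum_ite_eq', h1, h2, h3, h4, h5,
      if_true]
    ring
  have sum_fval' : ∀ g : Site 2 → ℝ, ∑ s ∈ Λ₀, g s * fval s = 2 * g (toSite (0, 2)) + 2 * g (toSite (8, 2))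
      - g (toSite (4, 4)) - g (toSite (4, 0)) - 2 * g (toSite (4, 2)) := fun g => by
    rw [← sum_fval]; exact Finset.sum_congr rfl fun s _ => mul_comm _ _
  have hiff : Summit.CriticalPhenomena.SAWScalingLimit.Theses.SAWEdgeOfPositiveType.InfiniteDivisibility ↔
      ∀ (Λ : Finset (Site 2)) (x t : ℝ), 0 ≤ x → x ≤ SAW.criticalFugacity → 0 < t →
        (Matrix.of fun a b : Λ => Zfun Λ x a.1 b.1 ^ t).PosDef := Iff.rfl
  rw [hiff]
  intro h
  have hxc : (1 / 16 : ℝ) ≤ SAW.criticalFugacity := le_trans (by norm_num) SAW.one_third_le_criticalFugacity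
  have hPD := h Λ₀ (1 / 16) ((1 : ℝ) / 256) (by norm_num) hxc (by norm_num)
  let v : Λ₀ → ℝ := fun a => fval a.1
  have hv : v ≠ 0 := by
    intro hv0
    have := congrFun hv0 ⟨toSite (0, 2), memΛ' (by decide)⟩
    simp only [v, fval, toSite_inj.eq_iff, Pi.zero_apply] at this
    norm_num at this
  have hpos := hPD.dotProduct_mulVec_pos hv
  have hform : dotProduct (star v) ((Matrix.of fun a b : Λ₀ => Zfun Λ₀ (1 / 16) a.1 b.1 ^ ((1 : ℝ) / 256)).mulVec v) =
      ∑ a ∈ Λ₀, fval a * ∑ b ∈ Λ₀, Zfun Λ₀ (1 / 16) a b ^ ((1 : ℝ) / 256) * fval b := by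
    simp only [dotProduct, Matrix.mulVec, Matrix.of_apply, star_trivial, v]
    rw [← Finset.sum_coe_sort Λ₀ (fun a => fval a * ∑ b ∈ Λ₀, Zfun Λ₀ (1 / 16) a b ^ ((1 : ℝ) / 256) * fval b)]
    refine Finset.sum_congr rfl fun a _ => ?_
    rw [← Finset.sum_coe_sort Λ₀ (fun b => Zfun Λ₀ (1 / 16) a.1 b ^ ((1 : ℝ) / 256) * fval b)]
  rw [hform] at hpos
  simp only [sum_fval'] at hpos
  rw [sum_fval] at hpos
  simp only [diag (0, 2) (by decide) (by decide), diag (8, 2) (by decide) (by decide),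
    diag (4, 4) (by decide) (by decide), diag (4, 0) (by decide) (by decide),
    diag (4, 2) (by decide) (by decide), Real.one_rpow] at hpos
  linarith [up (0, 2) (8, 2) _ _ hsUU (by norm_num) (by decide), up (8, 2) (0, 2) _ _ hsUU (by norm_num) (by decide),
    up (4, 4) (4, 0) _ _ hsTB (by norm_num) (by decide), up (4, 0) (4, 4) _ _ hsTB (by norm_num) (by decide),
    up (4, 4) (4, 2) _ _ hsTM (by norm_num) (by decide), up (4, 2) (4, 4) _ _ hsTM (by norm_num) (by decide),
    up (4, 0) (4, 2) _ _ hsTM (by norm_num) (by decide), up (4, 2) (4, 0) _ _ hsTM (by norm_num) (by decide),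
    low (0, 2) (4, 4) 6 (by norm_num) _ (by norm_num) hr6 [(0,2),(0,3),(0,4),(1,4),(2,4),(3,4),(4,4)] rfl rfl rfl
      (by decide) (by decide) (by decide),
    low (4, 4) (0, 2) 6 (by norm_num) _ (by norm_num) hr6 [(4,4),(3,4),(2,4),(1,4),(0,4),(0,3),(0,2)] rfl rfl rfl
      (by decide) (by decide) (by decide),
    low (0, 2) (4, 0) 6 (by norm_num) _ (by norm_num) hr6 [(0,2),(0,1),(0,0),(1,0),(2,0),(3,0),(4,0)] rfl rfl rfl
      (by decide) (by decide) (by decide),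
    low (4, 0) (0, 2) 6 (by norm_num) _ (by norm_num) hr6 [(4,0),(3,0),(2,0),(1,0),(0,0),(0,1),(0,2)] rfl rfl rfl
      (by decide) (by decide) (by decide),
    low (8, 2) (4, 4) 6 (by norm_num) _ (by norm_num) hr6 [(8,2),(8,3),(8,4),(7,4),(6,4),(5,4),(4,4)] rfl rfl rfl
      (by decide) (by decide) (by decide),
    low (4, 4) (8, 2) 6 (by norm_num) _ (by norm_num) hr6 [(4,4),(5,4),(6,4),(7,4),(8,4),(8,3),(8,2)] rfl rfl rfl
      (by decide) (by decide) (by decide),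
    low (8, 2) (4, 0) 6 (by norm_num) _ (by norm_num) hr6 [(8,2),(8,1),(8,0),(7,0),(6,0),(5,0),(4,0)] rfl rfl rfl
      (by decide) (by decide) (by decide),
    low (4, 0) (8, 2) 6 (by norm_num) _ (by norm_num) hr6 [(4,0),(5,0),(6,0),(7,0),(8,0),(8,1),(8,2)] rfl rfl rfl
      (by decide) (by decide) (by decide),
    low (0, 2) (4, 2) 4 (by norm_num) _ (by norm_num) hr4 [(0,2),(1,2),(2,2),(3,2),(4,2)] rfl rfl rfl
      (by decide) (by decide) (by decide),
    low (4, 2) (0, 2) 4 (by norm_num) _ (by norm_num) hr4 [(4,2),(3,2),(2,2),(1,2),(0,2)] rfl rfl rfl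
      (by decide) (by decide) (by decide),
    low (8, 2) (4, 2) 4 (by norm_num) _ (by norm_num) hr4 [(8,2),(7,2),(6,2),(5,2),(4,2)] rfl rfl rfl
      (by decide) (by decide) (by decide),
    low (4, 2) (8, 2) 4 (by norm_num) _ (by norm_num) hr4 [(4,2),(5,2),(6,2),(7,2),(8,2)] rfl rfl rfl
      (by decide) (by decide) (by decide)]

end Summit.CriticalPhenomena.SAWScalingLimit.Theorems
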